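import Summits.ResolutionOfSingularities.ResolutionOfSingularities.Theorems.HomologicalConductorNoZenoBirthDefs
import Summits.ResolutionOfSingularities.ResolutionOfSingularities.Theorems.HomologicalConductorNoZenoNoetherianCase
import Summits.ResolutionOfSingularities.ResolutionOfSingularities.Theorems.HomologicalConductorNoZenoTowerNoetherian
import Summits.ResolutionOfSingularities.ResolutionOfSingularities.Theorems.HomologicalConductorNoZenoDominanceInvariance
import Summits.ResolutionOfSingularities.ResolutionOfSingularities.Theorems.HomologicalConductorNoZenoIffKernel
import Summits.ResolutionOfSingularities.ResolutionOfSingularities.Theorems.HomologicalConductorNoZenoDim2RegularCentre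
import Summits.ResolutionOfSingularities.ResolutionOfSingularities.Theorems.HomologicalConductorNoZenoUnitOfRegularCentre
import Summits.ResolutionOfSingularities.ResolutionOfSingularities.Theorems.HomologicalConductorNoZenoDim2ResidualACC
import Summits.ResolutionOfSingularities.ResolutionOfSingularities.Theorems.HomologicalConductorNoZenoDim2Exhaustion
import Summits.ResolutionOfSingularities.ResolutionOfSingularities.Theorems.HomologicalConductorSurfaceTerminationRegimes
import Summits.ResolutionOfSingularities.ResolutionOfSingularities.Theorems.SyzygyFlatteningHigherRankTerminationLocAt
import Literature.AlgebraicGeometry.Resolution.DivisorialPlace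
import Literature.AlgebraicGeometry.Resolution.AffineDomainDimension
import Literature.AlgebraicGeometry.Resolution.LocalUniformization
import HarnessLib

/-!
# Route `HomologicalConductor`, support `SurfaceTermination` (stmt-ResolutionOfSingularities-16488): local-drop regimes

Companion of `Theorems/HomologicalConductorSurfaceTerminationRegimes.lean` (R0 low centre, R2
capture). Chain W4.4 (`L/w44/CHAIN.md` §3.2a) types the regimes of the unconditional support item
`SurfaceTermination` over the named tower `tower O A m` of
`Theorems/HomologicalConductorNoZenoBirthDefs.lean`, with the route crux `StrictDrop` replaced by
its DATUM-LOCAL form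

  `LocalDrop O A :≡ ∀ m, ¬ regular (T_m) → ∃ m' > m, ∃ y ∈ ca(T_m'), y ≠ 0 ∧ ∀ x ∈ ca(T_m), x ≠ 0 → y/x ∉ O`

(inlined below; nothing printed is restated). This file proves the regimes marked PROVABLE-NOW
there:

* **R1 `NoetherianLocal`** (`exists_regular_of_localDrop_of_isNoetherianRing`): along a
  NOETHERIAN valuation ring, local drop forces a regular stage — the proof of the landed
  `stub_noetherianCase` (p167613), which uses `StrictDrop` only at the datum.
* **relative chain condition, local form** (`exists_regular_of_localDrop_relativeACC`): the proof
  of the landed `stub_relativeACC` (p172572) with the datum-local drop.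
* **C2c `SurfaceCompositeLocal`** (`exists_regular_of_dropAlong_of_composite`): along a COMPOSITE
  (rank-two) valuation ring of a surface, drop along every valuation ring of the model forces
  termination, modulo the named fact `singEqVCa_essFiniteType` (IyengarTakahashi2014 Thm 5.4) —
  the argument of `NoZeno_of` case (4) (`Cruxes/NoZeno/Lines/birth.lean`), made local: either a
  noetherian valuation ring dominates the tower (R1 along it, dominance invariance p168418), or —
  Case B being impossible in dimension two (`exh_dominator_eq_of_kernel_of_trdeg_le_two`,
  p460241) — `O` is its tower's only dominator, the intermediate ring `O < O₁ < K` has regular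
  (height-one) centre on a late stage (p174043), `ca` there holds an `O₁`-unit (p173854), and the
  residual chain condition (p173988) lets the local relative chain condition terminate the tower.
* **R2 for divisorial places** (`exists_regular_of_exhausts_of_isDivisorialPlace`): the capture
  lemma in the binders of `Literature.AlgebraicGeometry.Resolution.IsDivisorialPlace`.

So, for the kill test K4.4: `SurfaceTermination` ⇐ R0 ∧ R1 ∧ D2 ∧ C2 ∧ C2c (mod IT14 5.4), and
after this file the OPEN content is exactly D2 (local drop for surfaces) and C2 (the rank-one
non-discrete core = registered stub `stub_kernelRankOneSurface` of crux `NoZeno` without the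
global hypotheses).

References: O. Zariski, P. Samuel, *Commutative Algebra* II, Ch. VI §10 (rank, composite
valuations) and §14 Thm. 31 [`ZariskiSamuel1960`]; S. Iyengar, R. Takahashi, *Annihilation of
cohomology and strong generation of module categories*, IMRN 2016, Thm. 5.4 [`IyengarTakahashi2014`].
-/

noncomputable section

-- single-problem summit: the doubled namespace component `ResolutionOfSingularities` is forced
set_option linter.dupNamespace false

namespace Summit.ResolutionOfSingularities.ResolutionOfSingularities.Theorems.SurfaceTermination.Regimes

open Summit.ResolutionOfSingularities.ResolutionOfSingularities.Theses.HomologicalConductor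
open Summit.ResolutionOfSingularities.ResolutionOfSingularities.Theorems.NoZeno.Birth
open Summit.ResolutionOfSingularities.ResolutionOfSingularities.Theorems.NoZeno.Negative
open Literature.AlgebraicGeometry.Resolution IsLocalRing

variable {k K : Type} [Field k] [Field K] [Algebra k K]

/-! ## R1 — noetherian valuation rings, local drop -/

/-- **R1 (`NoetherianLocal`).** Along a NOETHERIAN valuation ring `O` (a field or a DVR), the
datum-local value drop forces a regular stage: the drops would otherwise form a strictly ascending
chain of principal ideals of `O` (landed order skeleton `noZenoSkeleton_of_isNoetherianRing`).
[cite: ZariskiSamuel1960, Ch. VI §10] -/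
theorem exists_regular_of_localDrop_of_isNoetherianRing (O : ValuationSubring K)
    (A : Subalgebra k K) (hk : ∀ c : k, algebraMap k K c ∈ O) (hAO : A.toSubring ≤ O.toSubring)
    (hN : IsNoetherianRing ↥O)
    (hdrop : ∀ m : ℕ, ¬ IsRegularLocalRing ↥(tower O A m) → ∃ m' : ℕ, m < m' ∧
      ∃ y ∈ ca (tower O A m'), y ≠ 0 ∧ ∀ x ∈ ca (tower O A m), x ≠ 0 → y * x⁻¹ ∉ O) :
    ∃ m : ℕ, IsRegularLocalRing ↥(tower O A m) := by
  -- adapted from `Theorems/HomologicalConductorNoZenoNoetherianCase.lean` (p167613)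
  obtain ⟨m, hm⟩ := noZenoSkeleton_of_isNoetherianRing O hN
    (fun m => ¬ IsRegularLocalRing ↥(tower O A m)) (fun m => ca (tower O A m))
    (ca_tower_subset_valuationSubring O hk hAO) hdrop
  exact ⟨m, not_not.mp hm⟩

/-! ## The relative chain condition, local drop -/

/-- **Relative chain condition, local form.** The datum-local value drop terminates the tower
along `O` as soon as (i) some `ca(T_m₀)` contains a nonzero `c` with `c⁻¹ ∈ U` for an overring
`U ≥ O`, and (ii) `O` has no infinite strictly ascending chain of principal ideals generated by
`U`-units: iterating the drop from `c`, each drop `y` of `zₙ` has `y⁻¹ = zₙ⁻¹ (zₙ y⁻¹) ∈ U`, a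
chain forbidden by (ii). [cite: ZariskiSamuel1960, Ch. VI §10] -/
theorem exists_regular_of_localDrop_relativeACC (O : ValuationSubring K) (A : Subalgebra k K)
    (hk : ∀ c : k, algebraMap k K c ∈ O) (hAO : A.toSubring ≤ O.toSubring)
    (hdrop : ∀ m : ℕ, ¬ IsRegularLocalRing ↥(tower O A m) → ∃ m' : ℕ, m < m' ∧
      ∃ y ∈ ca (tower O A m'), y ≠ 0 ∧ ∀ x ∈ ca (tower O A m), x ≠ 0 → y * x⁻¹ ∉ O)
    (U : ValuationSubring K) (hOU : O ≤ U)
    (hunit : ∃ m : ℕ, ∃ c ∈ ca (tower O A m), c ≠ 0 ∧ c⁻¹ ∈ U)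
    (hacc : ∀ z : ℕ → K, (∀ n : ℕ, z n ∈ O ∧ z n ≠ 0 ∧ (z n)⁻¹ ∈ U) →
      (∀ n : ℕ, z n * (z (n + 1))⁻¹ ∈ O) → ∃ n : ℕ, z (n + 1) * (z n)⁻¹ ∈ O) :
    ∃ m : ℕ, IsRegularLocalRing ↥(tower O A m) := by
  -- adapted from `Theorems/HomologicalConductorNoZenoRelativeACC.lean` (p172572)
  by_contra hcon
  push Not at hcon
  have hstep : ∀ q : {q : ℕ × K // q.2 ∈ ca (tower O A q.1) ∧ q.2 ≠ 0 ∧ q.2⁻¹ ∈ U},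
      ∃ q' : {q : ℕ × K // q.2 ∈ ca (tower O A q.1) ∧ q.2 ≠ 0 ∧ q.2⁻¹ ∈ U},
        q'.1.2 * (q.1.2)⁻¹ ∉ O := by
    rintro ⟨⟨m, x⟩, hx, hx0, hxU⟩
    obtain ⟨m', -, y, hy, hy0, hlt⟩ := hdrop m (hcon m)
    have h1 : y * x⁻¹ ∉ O := hlt x hx hx0
    have h2 : x * y⁻¹ ∈ O := by
      rcases O.mem_or_inv_mem (y * x⁻¹) with h | h
      · exact absurd h h1
      · rwa [mul_inv_rev, inv_inv] at h
    have h3 : y⁻¹ ∈ U := by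
      have h4 : x⁻¹ * (x * y⁻¹) ∈ U := U.mul_mem _ _ hxU (hOU h2)
      rwa [inv_mul_cancel_left₀ hx0] at h4
    exact ⟨⟨(m', y), hy, hy0, h3⟩, h1⟩
  choose F hF using hstep
  obtain ⟨m₀, c, hc, hc0, hcU⟩ := hunit
  obtain ⟨s, hs⟩ : ∃ s : ℕ → {q : ℕ × K // q.2 ∈ ca (tower O A q.1) ∧ q.2 ≠ 0 ∧ q.2⁻¹ ∈ U},
      ∀ n : ℕ, s (n + 1) = F (s n) :=
    ⟨fun n => Nat.rec ⟨(m₀, c), hc, hc0, hcU⟩ (fun _ q => F q) n, fun _ => rfl⟩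
  obtain ⟨n, hn⟩ := hacc (fun n => (s n).1.2)
    (fun n => ⟨ca_tower_subset_valuationSubring O hk hAO (s n).1.1 (s n).2.1, (s n).2.2.1,
      (s n).2.2.2⟩)
    (fun n => by
      rcases O.mem_or_inv_mem ((F (s n)).1.2 * ((s n).1.2)⁻¹) with h | h
      · exact absurd h (hF (s n))
      · rw [mul_inv_rev, inv_inv] at h
        show (s n).1.2 * ((s (n + 1)).1.2)⁻¹ ∈ O
        rw [hs n]
        exact h)
  have hn' : (s (n + 1)).1.2 * ((s n).1.2)⁻¹ ∈ O := hn
  rw [hs n] at hn'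
  exact hF (s n) hn'

/-! ## C2c — composite valuations of surfaces, drop along the model -/

/-- **C2c (`SurfaceCompositeLocal`), modulo IyengarTakahashi2014 Thm 5.4.** Let `A` be a
two-dimensional affine model of `K/k` inside a COMPOSITE valuation ring `O` (`O < O₁ < K` for
some `O₁`), and assume value drop along every valuation ring `O' ⊇ k ∪ A` (the datum-local form
of `StrictDrop`, for all valuations of the model). Then the tower along `O` reaches a regular
stage. Either some noetherian valuation ring `O'` dominates the tower — then the `O'`-tower is the
`O`-tower (dominance invariance) and R1 applies along `O'` — or none does: then (dimension two)
`O` is the ONLY dominator of its tower (`exh_dominator_eq_of_kernel_of_trdeg_le_two`), so `O₁`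
fails to dominate, i.e. some stage holds a non-unit `s` of `O` with `s⁻¹ ∈ O₁`; past it the centre
of `O₁` on a stage is a height-one prime with regular (DVR) local ring (`stub_dim2RegularCentre`),
Theorem 5.4 puts an `O₁`-unit into `ca` there (`stub_unitOfRegularCentre`), the residual valuation
`O/𝔪_{O₁}` is a DVR of a function field of a curve (`stub_dim2ResidualACC`), and the local
relative chain condition terminates the tower. [cite: ZariskiSamuel1960, Ch. VI §10] -/
theorem exists_regular_of_dropAlong_of_composite
    (h54 : Literature.RingTheory.CohomologyAnnihilator.singEqVCa_essFiniteType.{0})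
    (p : ℕ) (hp : p.Prime) (k K : Type) [Field k] [CharP k p] [Field K] [Algebra k K]
    (O : ValuationSubring K) (A : Subalgebra k K) (hk : ∀ c : k, algebraMap k K c ∈ O)
    (hA : A.FG) (hfr : IsFractionRing ↥A K) (hAO : A.toSubring ≤ O.toSubring)
    (hdimA : ringKrullDim ↥A = 2) (hcomp : ∃ O₁ : ValuationSubring K, O < O₁ ∧ O₁ ≠ ⊤)
    (hdropAlong : ∀ O' : ValuationSubring K, (∀ c : k, algebraMap k K c ∈ O') →
      A.toSubring ≤ O'.toSubring →
      ∀ m : ℕ, ¬ IsRegularLocalRing ↥(tower O' A m) → ∃ m' : ℕ, m < m' ∧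
        ∃ y ∈ ca (tower O' A m'), y ≠ 0 ∧ ∀ x ∈ ca (tower O' A m), x ≠ 0 → y * x⁻¹ ∉ O') :
    ∃ m : ℕ, IsRegularLocalRing ↥(tower O A m) := by
  -- adapted from `NoZeno_of` case (4), `Cruxes/NoZeno/Lines/birth.lean`
  haveI := hfr
  have _hp := hp
  have hN : ∀ n : ℕ, IsNoetherianRing ↥(tower O A n) :=
    fun n => stub_towerNoetherian k K O A hk hA hfr hAO n
  -- (1) a noetherian dominator: R1 along it
  by_cases h : ∃ O' : ValuationSubring K, IsNoetherianRing ↥O' ∧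
      ∀ m : ℕ, ∀ s ∈ tower O A m, s ∈ O' ∧ (s⁻¹ ∈ O' → s⁻¹ ∈ O)
  · obtain ⟨O', hNO', hdom⟩ := h
    have hTeq : ∀ m : ℕ, tower O' A m = tower O A m := fun m =>
      stub_dominanceInvariance k K O O' A hk hAO hN hdom m
    have hk' : ∀ c : k, algebraMap k K c ∈ O' :=
      fun c => (hdom 0 _ ((tower O A 0).algebraMap_mem c)).1
    have hAO' : A.toSubring ≤ O'.toSubring :=
      fun a ha => (hdom 0 a (mem_tower_of_mem O A 0 a ha)).1
    obtain ⟨m, hm⟩ := exists_regular_of_localDrop_of_isNoetherianRing O' A hk' hAO' hNO'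
      (hdropAlong O' hk' hAO')
    exact ⟨m, hTeq m ▸ hm⟩
  -- (2) no noetherian dominator: the kernel hypothesis along `O`
  have hker : ∀ O' : ValuationSubring K,
      (∀ m : ℕ, ∀ s ∈ tower O A m, s ∈ O' ∧ (s⁻¹ ∈ O' → s⁻¹ ∈ O)) → ¬ IsNoetherianRing ↥O' :=
    fun O' hdom hNO' => h ⟨O', hNO', hdom⟩
  -- dimension bookkeeping: `tr.deg_k K = dim A = 2`
  haveI : Algebra.FiniteType k ↥A := A.fg_iff_finiteType.mp hA
  obtain ⟨n, hnd, hnA⟩ := exists_ringKrullDim_eq_and_trdeg_eq k ↥A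
  have hn2 : n = 2 := by
    have h2 : ((n : ℕ∞) : WithBot ℕ∞) = ((2 : ℕ∞) : WithBot ℕ∞) := hnd.symm.trans hdimA
    exact_mod_cast h2
  have htr2 : Algebra.trdeg k K = 2 := by
    rw [(trdeg_eq_trdeg_of_isFractionRing A).trans hnA, hn2]; norm_cast
  have hKfg : (⊤ : IntermediateField k K).FG :=
    IntermediateField.fg_top_of_isFractionRing_of_finiteType k ↥A K
  -- `O₁` does not dominate: `O` is the only dominator (Case B impossible in dimension two)
  obtain ⟨O₁, hlt1, hne1⟩ := hcomp
  have hOU : O ≤ O₁ := hlt1.le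
  have hndom : ¬ ∀ m : ℕ, ∀ s ∈ tower O A m, s ∈ O₁ ∧ (s⁻¹ ∈ O₁ → s⁻¹ ∈ O) := fun hdom =>
    (ne_of_lt hlt1).symm
      (exh_dominator_eq_of_kernel_of_trdeg_le_two k K O A hk hA hfr hAO hker htr2.le O₁ hdom)
  obtain ⟨m₀, s, hs, hsw⟩ : ∃ m₀ : ℕ, ∃ s ∈ tower O A m₀, s⁻¹ ∈ O₁ ∧ s⁻¹ ∉ O := by
    by_contra hno
    push Not at hno
    exact hndom fun m s hs =>
      ⟨hOU (mem_valuationSubring_of_mem_tower O hk hAO m s hs), fun hi => hno m s hs hi⟩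
  obtain ⟨hsU, hsO⟩ := hsw
  -- the centre of `O₁` on the stage `T_(m₀+1)` is regular, so `ca` holds an `O₁`-unit there
  have hTO : (tower O A (m₀ + 1)).toSubring ≤ O₁.toSubring := fun x hx =>
    hOU (mem_valuationSubring_of_mem_tower O hk hAO (m₀ + 1) x hx)
  let 𝔭 : Ideal ↥(tower O A (m₀ + 1)) := centreIdeal (tower O A (m₀ + 1)) O₁ hTO
  have h𝔭 : ∀ x : ↥(tower O A (m₀ + 1)), x ∈ 𝔭 ↔ (x : K) ∈ O₁.nonunits := fun x =>
    mem_centreIdeal_iff_coe_mem_nonunits _ O₁ hTO x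
  have hreg : IsRegularLocalRing (Localization.AtPrime 𝔭) :=
    stub_dim2RegularCentre k K O A hk hA hfr hAO htr2 O₁ hOU hne1 m₀ s hs hsU hsO (m₀ + 1)
      (Nat.lt_succ_self m₀) 𝔭 h𝔭
  have hunit : ∃ m : ℕ, ∃ c ∈ ca (tower O A m), c ≠ 0 ∧ c⁻¹ ∈ O₁ :=
    ⟨m₀ + 1, stub_unitOfRegularCentre h54 k K O A hk hA hfr hAO O₁ hOU (m₀ + 1) 𝔭 h𝔭 hreg⟩
  -- the residual chain condition and the local relative chain condition
  exact exists_regular_of_localDrop_relativeACC O A hk hAO (hdropAlong O hk hAO) O₁ hOU hunit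
    (fun z hz hle => stub_dim2ResidualACC k K O hk hKfg htr2 O₁ hlt1 hne1 z hz hle)

/-! ## R2 for divisorial places -/

/-- A divisorial place `O` (`IsDivisorialPlace k O`: `k ⊆ O`, DVR, `O = B_{𝔪 ∩ B}` for a finitely
generated `B ⊆ O`) lies in `loc O B`. [folklore] -/
theorem exists_le_loc_of_isDivisorialPlace (O : ValuationSubring K) (h : IsDivisorialPlace k O) :
    ∃ B : Subalgebra k K, B.FG ∧ B.toSubring ≤ O.toSubring ∧
      O.toSubring ≤ (loc O B).toSubring := by
  obtain ⟨B, hB, hBO, hfrac⟩ := h.exists_subalgebra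
  refine ⟨B, hB, hBO, fun x hx => ?_⟩
  obtain ⟨b, s, hb, hs, hsu, hxs⟩ := hfrac x hx
  have hs0 : s ≠ 0 := fun h0 => hsu (O.mem_nonunits_iff_or.mpr (Or.inl h0))
  have hsinv : s⁻¹ ∈ O := by
    rcases O.mem_nonunits_iff_or.not.mp hsu |> not_or.mp with ⟨-, h⟩
    exact not_not.mp h
  have hx' : x = b * s⁻¹ := by rw [← hxs, mul_inv_cancel_right₀ hs0]
  rw [Subalgebra.mem_toSubring, hx', loc_eq_locAt]
  exact SyzygyFlattening.mul_inv_mem_locAt O B hb hs hsinv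

/-- **R2 (`CaptureRegular`) for divisorial places.** If `O` is a divisorial place of `K/k` and
the stages of the tower exhaust `O`, some stage equals `O` and is regular (a DVR): the finitely
many generators of `B` (`O = B_{𝔪 ∩ B}`) lie in one stage `T_m`, so `O ≤ loc O B ≤ loc O T_m = T_m ≤ O`
(`exists_regular_of_exhausts`). [cite: ZariskiSamuel1960, VI §5] -/
theorem exists_regular_of_exhausts_of_isDivisorialPlace (p : ℕ) (hp : p.Prime) (k K : Type)
    [Field k] [CharP k p] [Field K] [Algebra k K] (O : ValuationSubring K) (A : Subalgebra k K)
    (hk : ∀ c : k, algebraMap k K c ∈ O) (hA : A.FG) (hfr : IsFractionRing ↥A K)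
    (hAO : A.toSubring ≤ O.toSubring) (hdiv : IsDivisorialPlace k O)
    (hexh : ∀ x : K, x ∈ O → ∃ m : ℕ, x ∈ tower O A m) :
    ∃ m : ℕ, IsRegularLocalRing ↥(tower O A m) := by
  have _hp := hp; have _hA := hA; have _hfr := hfr
  obtain ⟨B, hB, hBO, hOB⟩ := exists_le_loc_of_isDivisorialPlace O hdiv
  haveI : IsDiscreteValuationRing ↥O := hdiv.isDiscreteValuationRing
  exact exists_regular_of_exhausts O A hk hAO B hB hOB fun x hx => hexh x (hBO hx)

end Summit.ResolutionOfSingularities.ResolutionOfSingularities.Theorems.SurfaceTermination.Regimes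

end
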